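import Summits.BirchSwinnertonDyer.Rank1Residual.Additive.X4RankZeroKatoBoundSharp
import HarnessLib

/-!
# X4♯(3) on its potentially-good, big-image rows from the MANIN-FREE sharpened Kato 2004 Thm. 14.5 (3) reading: the V20♯ chain WITHOUT the modular-parametrisation datum (cell `b2b-bsdres`, team n1011 row T-b5; consumers by seat p08 of the fact A161′ typed by n1011-lit / lit-kato, p252712)

HONEST FRAMING (cell `b2b-bsdres`, run/shared/lean/b2b/bsd-rank1-residual/, verbatim in every
file): the goal of the cell is to DELETE the COMBINATION-SHAPED residual classes of the
Birch–Swinnerton-Dyer formula for ALL analytic-rank `≤ 1` elliptic curves over `ℚ` — "full BSD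
formula for every rank `≤ 1` curve in class `C`" assembled STRICTLY from published theorems — so
that the rank-`≤ 1` remainder becomes exactly the CONSTRUCTION-SHAPED classes, which are TYPED
(missing-input `Prop`s), NOT attempted. This is not "finishing BSD". Team n1011 (N10 / N11): prove
what is provable now; shrink each hard class to its core with data; no claim beyond stated classes;
research routes; census output = EVIDENCE / conjecture items, never a Literature fact; RESIDUAL-MAP
marks change only by signed lines; nothing is booked by this file.

**What this file proves** (theorems only; no definition, no new named fact). It is the sibling of
`X4RankZeroKatoBoundSharp.lean` (line V20♯, fact A161 =
`Kato2004.rankZero_padicValNat_sha_le_sub_localTamagawa_of_additive_potGood_of_imageContainsSL2`,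
which carries a vestigial binder `D : ModularParametrizationData W N`, `p ∤ c_D`) with that fact
replaced by the MANIN-FREE reading A161′ =
`Kato2004.rankZero_padicValNat_sha_le_sub_localTamagawa_of_additive_potGood_of_imageContainsSL2_maninFree`
(route planner 2's ROUTE-2 §4 N1; text by lit-kato GEN 9, proposed by n1011-lit, p252712 ACCEPTED;
referee 2's ruling: Kato's Thm. 14.5 (3) takes ANY stable lattice `T` and any `γ` with the basis
condition, so `T = T_pE`, `γ = γ_E`, `ω = ω_E` are admissible and the Manin constant never enters —
Kato, Astérisque 295, p. 236). Every theorem below is the datum-free twin of the same-named `…katoSharp…`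
theorem of the sibling: `padicValNat_shaOrder_le_of_katoManinFree_rankZero` (class-agnostic core:
`#Ш_an = q`, `ord_p #Ш ≤ ord_p q + ord_p ∏c − v_p(c_p) − 2 ord_p #tors`),
`X4RankZero.padicValNat_shaOrder_le_of_katoManinFree`, `X4RankZero.missingUpperBoundAt_of_katoManinFree`
(the typed UPPER half on `ord_p ∏c = v_p(c_p)` rows), `X4RankZero.bsdp_of_shaAn_unit_of_katoManinFree`,
`X4RankZero.bsdp_three_of_katoManinFree_of_surj_of_ram` (**`BSD(E,3)` on X4 ∧ r = 0 ∧ pot-good ∧ surj(3)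
∧ ram(3) ∧ `ord₃ ∏c = v₃(c₃)` ∧ `3 ∤ #Ш_an` — NO Manin / optimality datum**),
`x4SharpThree_holds_of_potGood_of_towerSurj_maninFree`, and the bridge
`katoManinFree_of_katoManinFree` restating that every V20♯ consumer follows from A161′ (Literature
`…_of_maninFree`). Consequence for the census (referee A R196.7 "flags stay until a row without a
Manin binder closes the cell"): the 1 751 MANIN-DB@3 cells of the V20X transport (V2M) have, with
this file, kernel closure shapes WITHOUT the Manin datum — booking is the lane's / director's, not
this file's; the flag `Kato-14.5(3)-14.16(2)-additive-potgood-reading-sharp` (tier D reading-fact,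
formal D-audit owed) travels with every theorem here exactly as with the V20♯ ones.
Per pair; the class label X4 is UNCHANGED (CONSTRUCTION-SHAPED); nothing is booked by this file.

References: Kato 2004 [Kato2004Asterisque] Thm. 14.5 (3) (p. 236), Prop. 14.16 (2) (p. 244), §14.8,
Thm. 12.5 (1); Kim 2026 [Kim2022StructureSelmer] §3.2.3 display (PDF p. 16), Remark 3.8, Lemma 3.10;
Miller 2011 [Miller2011LMS] Def. 1.1; Mazur 1977 [Mazur1977] III.5 (torsion vs irreducibility).
-/

noncomputable section

open scoped Classical

namespace Summit.BirchSwinnertonDyer.Rank1Residual.Additive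

open WeierstrassCurve Literature.NumberTheory.EllipticCurves
  Literature.NumberTheory.EllipticCurves.ModularForms
  Literature.NumberTheory.EllipticCurves.Rank1Residual
  Literature.NumberTheory.EllipticCurves.Rank1Residual.Typed

variable (W : WeierstrassCurve ℚ) [W.IsElliptic] [W.IsGloballyMinimal] (p : ℕ) [Fact p.Prime]

/-- **Rank-`0` upper bound with the torsion term AND the local Tamagawa term, from the MANIN-FREE
sharpened Kato reading A161′** (Kato 14.5 (3) + 14.16 (2), Kim §3.2.3 display): `#Ш_an = q` and
`ord_p #Ш ≤ ord_p q + ord_p ∏ c_ℓ − v_p(c_p) − 2 ord_p #E(ℚ)_tors`. No Tamagawa hypothesis, NO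
modular-parametrisation datum (twin of `padicValNat_shaOrder_le_of_katoSharp_rankZero`).
[cite: Kato2004Asterisque, Thm. 14.5 (3) (p. 236), Prop. 14.16 (2) (p. 244)] [cite: Miller2011LMS, Def. 1.1] -/
theorem padicValNat_shaOrder_le_of_katoManinFree_rankZero
    (hKato : Kato2004.rankZero_padicValNat_sha_le_sub_localTamagawa_of_additive_potGood_of_imageContainsSL2_maninFree)
    (hGZK : rank_eq_analyticRank_of_analyticRank_le_one) (hmod : hasEntireLFunction_rat)
    (hp : p ≠ 2) (hgood : ¬ W.HasGoodReductionAtPrime p) (hmult : ¬ W.HasMultiplicativeReductionAtPrime p)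
    (hpot : 0 ≤ padicValRat p W.j) (hbig : Kato2004.ImageContainsSL2 W p) (hr : W.analyticRank = 0) :
    ∃ q : ℚ, shaAn W = (q : ℂ) ∧
      (padicValNat p W.shaOrder : ℤ) ≤
        padicValRat p q + padicValNat p W.tamagawaProduct - padicValNat p ((W.baseChange ℚ_[p]).localTamagawaNumber ℤ_[p])
          - 2 * padicValNat p W.torsionOrder := by
  have hL : W.entireLFunction 1 ≠ 0 := (W.analyticRank_eq_zero_iff_holds (hmod W)).mp hr
  obtain ⟨hmw, hfin⟩ := hGZK W (by rw [hr]; exact zero_le_one)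
  haveI : Finite W.sha := hfin
  have hmw0 : W.mordellWeilRank = 0 := by rw [hmw, hr]
  obtain ⟨q₀, hq₀, hle⟩ := hKato W p hp hgood hmult hpot hbig hL hfin
  have hΩpos : 0 < W.realPeriodRat := W.realPeriodRat_pos_holds
  have hΩ : (W.realPeriodRat : ℂ) ≠ 0 := by exact_mod_cast hΩpos.ne'
  have hc0 : 0 < W.tamagawaProduct := W.tamagawaProduct_pos_holds
  have ht0 : 0 < W.torsionOrder := W.torsionOrder_pos_holds
  have hq₀0 : q₀ ≠ 0 := by
    rintro rfl
    rw [Rat.cast_zero, div_eq_zero_iff] at hq₀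
    exact hq₀.elim hL hΩ
  refine ⟨q₀ * (W.torsionOrder : ℚ) ^ 2 / (W.tamagawaProduct : ℚ), ?_, ?_⟩
  · have hLq : W.entireLFunction 1 = (q₀ : ℂ) * (W.realPeriodRat : ℂ) := by
      rw [← hq₀, div_mul_cancel₀ _ hΩ]
    rw [shaAn_def, leadingLCoeff_eq_of_analyticRank_eq_zero W hr,
      W.regulator_eq_one_of_rank_zero hmw0, hLq]
    push_cast
    field_simp
  · have ht : (W.torsionOrder : ℚ) ≠ 0 := by exact_mod_cast ht0.ne'
    have hcq : (W.tamagawaProduct : ℚ) ≠ 0 := by exact_mod_cast hc0.ne'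
    have hsha : padicValNat p (Nat.card (AddCommGroup.primaryComponent W.sha p)) =
        padicValNat p W.shaOrder := by
      unfold WeierstrassCurve.shaOrder
      exact padicValNat_card_addPrimaryComponent p
    have hv : padicValRat p (q₀ * (W.torsionOrder : ℚ) ^ 2 / (W.tamagawaProduct : ℚ)) =
        padicValRat p q₀ + 2 * (padicValNat p W.torsionOrder : ℤ) -
          (padicValNat p W.tamagawaProduct : ℤ) := by
      rw [padicValRat.div (mul_ne_zero hq₀0 (pow_ne_zero 2 ht)) hcq,
        padicValRat.mul hq₀0 (pow_ne_zero 2 ht), pow_two, padicValRat.mul ht ht,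
        padicValRat.of_nat, padicValRat.of_nat]
      ring
    rw [hv, ← hsha]
    linarith

/-- **X4 ∧ `r = 0` at an odd potentially good additive `p` with tower surjectivity (no datum):
`ord_p #Ш ≤ ord_p #Ш_an + ord_p ∏ c_ℓ − v_p(c_p)`** (torsion term killed by irreducibility; twin of
`X4RankZero.padicValNat_shaOrder_le_of_katoSharp`).
[cite: Kato2004Asterisque, Thm. 14.5 (3) (p. 236), (12.5.2) (p. 222)] [cite: Mazur1977, Ch. III §5, p. 157] -/
theorem X4RankZero.padicValNat_shaOrder_le_of_katoManinFree
    (hKato : Kato2004.rankZero_padicValNat_sha_le_sub_localTamagawa_of_additive_potGood_of_imageContainsSL2_maninFree)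
    (hGZK : rank_eq_analyticRank_of_analyticRank_le_one) (hmod : hasEntireLFunction_rat)
    (hr : W.analyticRank = 0) (hX : ClassX4 W p) (hpot : 0 ≤ padicValRat p W.j)
    (hsurj : ∀ n : ℕ, W.HasSurjectiveModNGaloisRep (p ^ n : ℕ)) :
    ∃ q : ℚ, shaAn W = (q : ℂ) ∧
      (padicValNat p W.shaOrder : ℤ) ≤
        padicValRat p q + padicValNat p W.tamagawaProduct - padicValNat p ((W.baseChange ℚ_[p]).localTamagawaNumber ℤ_[p]) := by
  obtain ⟨hp2, ⟨hgood, hmult⟩, hirr⟩ := hX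
  obtain ⟨q, hq, hle⟩ :=
    padicValNat_shaOrder_le_of_katoManinFree_rankZero W p hKato hGZK hmod hp2 hgood hmult hpot
      (Kato2004.imageContainsSL2_of_forall_hasSurjectiveModNGaloisRep W p hsurj) hr
  refine ⟨q, hq, ?_⟩
  rw [padicValNat_torsionOrder_eq_zero_of_irreducible W p hirr] at hle
  simpa using hle

/-- **The typed UPPER half on the rows where `p` divides `∏ c_ℓ` ONLY through `c_p`**: X4 ∧ `r = 0`,
odd potentially good additive `p`, tower surjectivity, and the per-pair certificate
`ord_p ∏_ℓ c_ℓ = ord_p c_p` (i.e. `p ∤ c_ℓ` for `ℓ ≠ p`) ⟹ `MissingUpperBoundAt W p` — Manin-free twin of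
`X4RankZero.missingUpperBoundAt_of_katoSharp`.
[cite: Kato2004Asterisque, Thm. 14.5 (3) (p. 236)] [cite: Miller2011LMS, Def. 1.1] -/
theorem X4RankZero.missingUpperBoundAt_of_katoManinFree
    (hKato : Kato2004.rankZero_padicValNat_sha_le_sub_localTamagawa_of_additive_potGood_of_imageContainsSL2_maninFree)
    (hGZK : rank_eq_analyticRank_of_analyticRank_le_one) (hmod : hasEntireLFunction_rat)
    (hr : W.analyticRank = 0) (hX : ClassX4 W p) (hpot : 0 ≤ padicValRat p W.j)
    (hsurj : ∀ n : ℕ, W.HasSurjectiveModNGaloisRep (p ^ n : ℕ))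
    (htam : padicValNat p W.tamagawaProduct = padicValNat p ((W.baseChange ℚ_[p]).localTamagawaNumber ℤ_[p])) :
    MissingUpperBoundAt W p := by
  obtain ⟨q, hq, hle⟩ :=
    X4RankZero.padicValNat_shaOrder_le_of_katoManinFree W p hKato hGZK hmod hr hX hpot hsurj
  refine ⟨q, hq, ?_⟩
  rw [htam] at hle
  linarith

/-- **`BSD(E,p)` on these rows when `#Ш_an` is a `p`-unit**, Manin-free (twin of
`X4RankZero.bsdp_of_shaAn_unit_of_katoSharp`; in particular the V2M = MANIN-DB@3 rows of the V20X
transport get a closure shape with no optimality / Manin input).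
[cite: Kato2004Asterisque, Thm. 14.5 (3) (p. 236)] [cite: Miller2011LMS, §1 and Def. 1.1] -/
theorem X4RankZero.bsdp_of_shaAn_unit_of_katoManinFree
    (hKato : Kato2004.rankZero_padicValNat_sha_le_sub_localTamagawa_of_additive_potGood_of_imageContainsSL2_maninFree)
    (hGZK : rank_eq_analyticRank_of_analyticRank_le_one) (hmod : hasEntireLFunction_rat)
    (hr : W.analyticRank = 0) (hX : ClassX4 W p) (hpot : 0 ≤ padicValRat p W.j)
    (hsurj : ∀ n : ℕ, W.HasSurjectiveModNGaloisRep (p ^ n : ℕ))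
    (htam : padicValNat p W.tamagawaProduct = padicValNat p ((W.baseChange ℚ_[p]).localTamagawaNumber ℤ_[p]))
    {q : ℚ} (hq : shaAn W = (q : ℂ)) (hv : padicValRat p q = 0) : BSDp W p := by
  obtain ⟨q', hq', hle⟩ :=
    X4RankZero.missingUpperBoundAt_of_katoManinFree W p hKato hGZK hmod hr hX hpot hsurj htam
  have hqq : q' = q := by exact_mod_cast hq'.symm.trans hq
  subst hqq
  rw [hv] at hle
  have h0 : padicValNat p W.shaOrder = 0 := by exact_mod_cast le_antisymm hle (by positivity)
  exact bsdp_of_missingPPartAt W p hGZK (by rw [hr]; exact zero_le_one)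
    ⟨q', hq', by rw [hv, h0, Nat.cast_zero]⟩

/-- **Census shape at `p = 3`** (surj(3) ∧ ram(3) feed the tower surjectivity): X4 ∧ `r_an = 0` ∧
`ord_3 j ≥ 0` ∧ surj(3) ∧ ram(3) ∧ `ord_3 ∏ c_ℓ = ord_3 c_3` ∧ `3 ∤ #Ш_an` ⟹ `BSD(E,3)` — NO Manin /
optimality datum (twin of `X4RankZero.bsdp_three_of_katoSharp_of_surj_of_ram`).
[cite: Kato2004Asterisque, Thm. 14.5 (3) (p. 236), (12.5.2) (p. 222)] [cite: Miller2011LMS, §1 and Def. 1.1] -/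
theorem X4RankZero.bsdp_three_of_katoManinFree_of_surj_of_ram
    (hKato : Kato2004.rankZero_padicValNat_sha_le_sub_localTamagawa_of_additive_potGood_of_imageContainsSL2_maninFree)
    (hGZK : rank_eq_analyticRank_of_analyticRank_le_one) (hmod : hasEntireLFunction_rat)
    (hr : W.analyticRank = 0) (hX : ClassX4 W 3) (hpot : 0 ≤ padicValRat 3 W.j) (hsurj : Surj W 3)
    (hram : Ram W 3)
    (htam : padicValNat 3 W.tamagawaProduct =
      padicValNat 3 ((WeierstrassCurve.baseChange W ℚ_[3]).localTamagawaNumber ℤ_[3]))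
    {q : ℚ} (hq : shaAn W = (q : ℂ)) (hv : padicValRat 3 q = 0) : BSDp W 3 :=
  X4RankZero.bsdp_of_shaAn_unit_of_katoManinFree W 3 hKato hGZK hmod hr hX hpot
    (hasSurjectiveModNGaloisRep_pow_of_hasMultiplicativeReductionAtPrime W 3 hsurj hram) htam hq hv

/-- **X4♯(3)'s conclusion on EVERY potentially good, tower-surjective row — NO Tamagawa hypothesis,
NO Manin datum** (twin of `x4SharpThree_holds_of_potGood_of_towerSurj_sharp`): X4 ∧
`r_an = 0` ∧ `ord_3 j ≥ 0` ∧ `ρ̄_{E,3^n}` onto for all `n` ⟹ `#Ш_an = q` and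
`ord_3 #Ш ≤ ord_3 q + ord_3 ∏ c_ℓ` (drop the subtracted `v_3(c_3) ≥ 0` from
`X4RankZero.padicValNat_shaOrder_le_of_katoManinFree`). These are the rows of the conjecture
`Additive.X4SharpThree` left open only by `3 ∣ ∏ c_ℓ` on the potentially good tower-surjective locus.
[cite: Kato2004Asterisque, Thm. 14.5 (3) (p. 236), Prop. 14.16 (2) (p. 244)] [cite: Miller2011LMS, Def. 1.1] -/
theorem x4SharpThree_holds_of_potGood_of_towerSurj_maninFree
    (hKato : Kato2004.rankZero_padicValNat_sha_le_sub_localTamagawa_of_additive_potGood_of_imageContainsSL2_maninFree)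
    (hGZK : rank_eq_analyticRank_of_analyticRank_le_one) (hmod : hasEntireLFunction_rat)
    (hr : W.analyticRank = 0) (hX : ClassX4 W 3) (hpot : 0 ≤ padicValRat 3 W.j)
    (hsurj : ∀ n : ℕ, W.HasSurjectiveModNGaloisRep (3 ^ n : ℕ)) :
    ∃ q : ℚ, shaAn W = (q : ℂ) ∧
      (padicValNat 3 W.shaOrder : ℤ) ≤ padicValRat 3 q + padicValNat 3 W.tamagawaProduct := by
  obtain ⟨q, hq, hle⟩ :=
    X4RankZero.padicValNat_shaOrder_le_of_katoManinFree W 3 hKato hGZK hmod hr hX hpot hsurj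
  refine ⟨q, hq, hle.trans ?_⟩
  have h0 : (0 : ℤ) ≤ padicValNat 3 ((WeierstrassCurve.baseChange W ℚ_[3]).localTamagawaNumber ℤ_[3]) := by
    positivity
  linarith

end Summit.BirchSwinnertonDyer.Rank1Residual.Additive

end
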